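import Summits.AtomisticToContinuum.HydrodynamicLimit.Theorems.AntiMazurCoboundariesInfluenceLocalityObjects
import Summits.AtomisticToContinuum.HydrodynamicLimit.Theorems.JParityClosureCollisionTightnessSweptTube
import Summits.AtomisticToContinuum.HydrodynamicLimit.Theorems.JParityClosureCollisionTightnessTorusGibbs
import Literature.MathematicalPhysics.KineticTheory.CollisionFluxUpperBound
import Literature.MathematicalPhysics.KineticTheory.HardSphereCanonicalPairBound
import Mathlib.Probability.Distributions.Gaussian.Fernique

/-!
# Prelim B of stub `stub_trueCapsExist` (line `true-anchored-infection`, crux `InfluenceLocality`,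
# stmt-AtomisticToContinuum-13916; route AntiMazurCoboundaries): Maxwellian tails

Elementary Gaussian estimates for the isotropic law `γ_θ = gaussMeasure c θ = N(c, θ id)` on `ℝ³`
(density the local Maxwellian `M_{1,c,θ}`, `withDensity_localMaxwellian_eq_gaussMeasure`), in the
`ℝ≥0∞` form consumed by the collision-flux bounds of STUB 4 (`TrueCapsExist`):

* `TrueCaps.localMaxwellian_le_of_lt_norm` — on `{‖v - c‖ > u}` (`u ≥ 0`),
  `M_{1,c,θ}(v) ≤ 2^{3/2} e^{-u²/(4θ)} M_{1,c,2θ}(v)` (half of the Gaussian weight pays the tail,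
  the other half is a Maxwellian at temperature `2θ`);
* `trueCaps_gauss_tail` (registered prelim) — hence for measurable `g ≥ 0`,
  `∫ 𝟙{u < ‖v - c‖} g dγ_θ ≤ 2^{3/2} e^{-u²/(4θ)} ∫ g dγ_{2θ}` (`TrueCaps.tailC θ u`);
* `TrueCaps.Kmom c θ m = ∫ (1 + ‖v - c‖)^m dγ_θ` is finite (`Kmom_ne_top`: Gaussian measures have
  all moments, `ProbabilityTheory.IsGaussian.memLp_id`);
* `TrueCaps.exists_cube_mul_exp_neg_sqrt_le` — `∀ η > 0 ∃ R₀ ∀ R ≥ R₀, (1 + R)³ e^{-√R/4} ≤ η`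
  (`Real.tendsto_pow_mul_exp_neg_atTop_nhds_zero`), the decay of the assembled bound along the
  cap schedule `u(R)² = θ √R` (`TrueCaps.capSpeed`);
* the Gaussian flux integrals `TrueCaps.fastFlux`, `TrueCaps.nearFlux` (radius
  `TrueCaps.nearRadius`), `TrueCaps.ballFlux` that the collision-flux bounds of the stub produce
  (definitions and measurability only; they are estimated in the next prelim);
* the collision sum `TrueCaps.collSum` of a mark along a good orbit (the quantity bounded by
  `measure_collisionSum_ge_le_liminf`, written out), the summand lemma
  `TrueCaps.le_collSum_of_contact`, and `TrueCaps.exists_pairEvents` — the one-window events of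
  `exists_windowEvent` for all partners of a fixed label, with the swept tubes of
  `exists_sweptTube`, the pair bound `posGibbs_pairEvent_le` and the lift inequality
  `volume_setOf_exists_reprSym_add_latticeVec_mem_le` plugged in.
-/

namespace Summit.AtomisticToContinuum.HydrodynamicLimit.Theorems.TrueAnchoredInfection

open MeasureTheory Set Filter Topology Real
open scoped ENNReal
open Literature.Analysis.FluidPDE Literature.MathematicalPhysics.KineticTheory
open Literature.Analysis.FunctionSpaces

noncomputable section

namespace TrueCaps

/-! ## The tail factor and the density comparison -/

/-- The tail factor `2^{3/2} e^{-u²/(4θ)}`. -/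
def tailC (θ u : ℝ) : ℝ := (2 : ℝ) ^ ((3 : ℝ) / 2) * exp (-(u ^ 2 / (4 * θ)))

/-- The tail factor is nonnegative. -/
theorem tailC_nonneg (θ u : ℝ) : 0 ≤ tailC θ u := by unfold tailC; positivity

/-- **Density comparison on the tail**: for `θ > 0`, `0 ≤ u < ‖v - c‖`,
`M_{1,c,θ}(v) ≤ 2^{3/2} e^{-u²/(4θ)} M_{1,c,2θ}(v)`. -/
theorem localMaxwellian_le_of_lt_norm {θ u : ℝ} (hθ : 0 < θ) (hu : 0 ≤ u) {c v : V3} (hv : u < ‖v - c‖) :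
    localMaxwellian 1 θ c v ≤ tailC θ u * localMaxwellian 1 (2 * θ) c v := by
  have hd : (Module.finrank ℝ V3 : ℝ) = 3 := by
    rw [finrank_euclideanSpace_fin]; norm_num
  simp only [localMaxwellian, hd, one_mul, tailC]
  have h2πθ : 0 ≤ 2 * π * θ := by positivity
  have hsplit : (2 * π * (2 * θ)) ^ (-(3 : ℝ) / 2) = (2 : ℝ) ^ (-(3 : ℝ) / 2) * (2 * π * θ) ^ (-(3 : ℝ) / 2) := by
    rw [show 2 * π * (2 * θ) = 2 * (2 * π * θ) by ring, mul_rpow (by norm_num : (0 : ℝ) ≤ 2) h2πθ]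
  have hcancel : (2 : ℝ) ^ ((3 : ℝ) / 2) * (2 : ℝ) ^ (-(3 : ℝ) / 2) = 1 := by
    rw [← rpow_add (by norm_num : (0 : ℝ) < 2)]; norm_num
  have hexp : exp (-‖v - c‖ ^ 2 / (2 * θ)) ≤ exp (-(u ^ 2 / (4 * θ))) * exp (-‖v - c‖ ^ 2 / (2 * (2 * θ))) := by
    rw [← exp_add]
    refine exp_le_exp.2 ?_
    have hx : u ^ 2 ≤ ‖v - c‖ ^ 2 := pow_le_pow_left₀ hu hv.le 2
    have h4 : (0 : ℝ) < 4 * θ := by positivity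
    rw [show (2 : ℝ) * (2 * θ) = 4 * θ by ring, show -‖v - c‖ ^ 2 / (2 * θ) = -(2 * ‖v - c‖ ^ 2) / (4 * θ) by
      field_simp; ring, show -(u ^ 2 / (4 * θ)) + -‖v - c‖ ^ 2 / (4 * θ) = (-(u ^ 2) + -‖v - c‖ ^ 2) / (4 * θ) by ring,
      div_le_div_iff_of_pos_right h4]
    linarith
  calc (2 * π * θ) ^ (-(3 : ℝ) / 2) * exp (-‖v - c‖ ^ 2 / (2 * θ))
      ≤ (2 * π * θ) ^ (-(3 : ℝ) / 2) * (exp (-(u ^ 2 / (4 * θ))) * exp (-‖v - c‖ ^ 2 / (2 * (2 * θ)))) :=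
        mul_le_mul_of_nonneg_left hexp (rpow_nonneg h2πθ _)
    _ = (2 : ℝ) ^ ((3 : ℝ) / 2) * exp (-(u ^ 2 / (4 * θ))) *
          ((2 * π * (2 * θ)) ^ (-(3 : ℝ) / 2) * exp (-‖v - c‖ ^ 2 / (2 * (2 * θ)))) := by
        rw [hsplit]
        calc (2 * π * θ) ^ (-(3 : ℝ) / 2) * (exp (-(u ^ 2 / (4 * θ))) * exp (-‖v - c‖ ^ 2 / (2 * (2 * θ))))
            = ((2 : ℝ) ^ ((3 : ℝ) / 2) * (2 : ℝ) ^ (-(3 : ℝ) / 2)) * (2 * π * θ) ^ (-(3 : ℝ) / 2) *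
                (exp (-(u ^ 2 / (4 * θ))) * exp (-‖v - c‖ ^ 2 / (2 * (2 * θ)))) := by rw [hcancel, one_mul]
          _ = _ := by ring

end TrueCaps

open TrueCaps in
/-- **Registered prelim `trueCaps_gauss_tail`** (of `stub_trueCapsExist`): the Maxwellian tail in
`ℝ≥0∞` form. For `θ > 0`, `u ≥ 0`, a centre `c` and measurable `g ≥ 0`,
`∫ 𝟙{u < ‖v - c‖} g(v) dN(c, θ)(v) ≤ 2^{3/2} e^{-u²/(4θ)} · ∫ g dN(c, 2θ)`. -/
theorem trueCaps_gauss_tail : ∀ (θ u : ℝ) (c : V3) (g : V3 → ℝ≥0∞), 0 < θ → 0 ≤ u → Measurable g → ∫⁻ v, {v : V3 | u < ‖v - c‖}.indicator g v ∂(gaussMeasure c θ) ≤ ENNReal.ofReal (TrueCaps.tailC θ u) * ∫⁻ v, g v ∂(gaussMeasure c (2 * θ)) := by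
  intro θ u c g hθ hu hg
  have h2θ : 0 < 2 * θ := by positivity
  have hM1 : Measurable fun v : V3 => ENNReal.ofReal (localMaxwellian 1 θ c v) :=
    (continuous_localMaxwellian 1 θ c).measurable.ennreal_ofReal
  have hM2 : Measurable fun v : V3 => ENNReal.ofReal (localMaxwellian 1 (2 * θ) c v) :=
    (continuous_localMaxwellian 1 (2 * θ) c).measurable.ennreal_ofReal
  have hS : MeasurableSet {v : V3 | u < ‖v - c‖} := measurableSet_lt measurable_const (measurable_id.sub measurable_const).norm
  rw [← withDensity_localMaxwellian_eq_gaussMeasure hθ c, ← withDensity_localMaxwellian_eq_gaussMeasure h2θ c,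
    lintegral_withDensity_eq_lintegral_mul _ hM1 (hg.indicator hS), lintegral_withDensity_eq_lintegral_mul _ hM2 hg,
    ← lintegral_const_mul _ (hM2.mul hg)]
  refine lintegral_mono fun v => ?_
  simp only [Pi.mul_apply]
  by_cases hv : v ∈ {v : V3 | u < ‖v - c‖}
  · rw [indicator_of_mem hv, ← mul_assoc, ← ENNReal.ofReal_mul (tailC_nonneg θ u)]
    gcongr
    exact localMaxwellian_le_of_lt_norm hθ hu hv
  · rw [indicator_of_notMem hv, mul_zero]
    exact bot_le

namespace TrueCaps

/-- The tail of the fast event itself: `N(c, θ){u < ‖v - c‖} ≤ 2^{3/2} e^{-u²/(4θ)}`. -/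
theorem measure_fast_le {θ u : ℝ} (hθ : 0 < θ) (hu : 0 ≤ u) (c : V3) :
    gaussMeasure c θ {v : V3 | u < ‖v - c‖} ≤ ENNReal.ofReal (tailC θ u) := by
  have hS : MeasurableSet {v : V3 | u < ‖v - c‖} := measurableSet_lt measurable_const (measurable_id.sub measurable_const).norm
  have h := trueCaps_gauss_tail θ u c 1 hθ hu measurable_const
  rw [lintegral_indicator_one hS] at h
  simpa only [Pi.one_apply, lintegral_const, measure_univ, mul_one] using h

/-! ## Moments -/

/-- The moment integrals `K_m(θ) = ∫ (1 + ‖v - c‖)^m dN(c, θ)(v)`. -/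
def Kmom (c : V3) (θ : ℝ) (m : ℕ) : ℝ≥0∞ :=
  ∫⁻ v, ENNReal.ofReal ((1 + ‖v - c‖) ^ m) ∂(gaussMeasure c θ)

/-- **Gaussian measures have all moments**: `K_m(θ) < ∞`. -/
theorem Kmom_ne_top (c : V3) (θ : ℝ) (m : ℕ) : Kmom c θ m ≠ ∞ := by
  have hmem : MemLp (fun v : V3 => v - c) (m : ℝ≥0∞) (gaussMeasure c θ) :=
    (ProbabilityTheory.IsGaussian.memLp_id (gaussMeasure c θ) m (ENNReal.natCast_ne_top m)).sub (memLp_const c)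
  have hint : Integrable (fun v : V3 => ‖v - c‖ ^ m) (gaussMeasure c θ) := hmem.integrable_norm_pow'
  have hint2 : Integrable (fun v : V3 => (2 : ℝ) ^ m * (1 + ‖v - c‖ ^ m)) (gaussMeasure c θ) :=
    ((integrable_const 1).add hint).const_mul _
  -- `(1 + x)^m ≤ 2^m (1 + x^m)` for `x ≥ 0` (as in `BMOInv.one_add_pow_le_two_pow_mul`)
  have key : ∀ x : ℝ, 0 ≤ x → (1 + x) ^ m ≤ 2 ^ m * (1 + x ^ m) := by
    intro x hx
    rcases le_or_gt x 1 with h | h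
    · calc (1 + x) ^ m ≤ 2 ^ m := pow_le_pow_left₀ (by positivity) (by linarith) m
        _ ≤ 2 ^ m * (1 + x ^ m) := le_mul_of_one_le_right (by positivity) (by nlinarith [pow_nonneg hx m])
    · calc (1 + x) ^ m ≤ (2 * x) ^ m := pow_le_pow_left₀ (by positivity) (by linarith) m
        _ = 2 ^ m * x ^ m := mul_pow 2 x m
        _ ≤ 2 ^ m * (1 + x ^ m) := by gcongr; linarith
  have hle : ∀ v : V3, ENNReal.ofReal ((1 + ‖v - c‖) ^ m) ≤ ENNReal.ofReal ((2 : ℝ) ^ m * (1 + ‖v - c‖ ^ m)) :=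
    fun v => ENNReal.ofReal_le_ofReal (key _ (norm_nonneg _))
  refine ne_top_of_le_ne_top ?_ (lintegral_mono hle)
  exact ((hasFiniteIntegral_iff_ofReal (Eventually.of_forall fun v => by positivity)).1 hint2.hasFiniteIntegral).ne

/-- The moment integrands are measurable. -/
theorem measurable_one_add_norm_pow (c : V3) (m : ℕ) :
    Measurable fun v : V3 => ENNReal.ofReal ((1 + ‖v - c‖) ^ m) := by
  fun_prop

/-- `K_0 = 1`. -/
theorem Kmom_zero (c : V3) (θ : ℝ) : Kmom c θ 0 = 1 := by
  simp [Kmom]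

/-! ## The cap schedule and the decay of the assembled bound -/

/-- The SPEED CAP SCHEDULE of STUB 4: `u(R) = (θ √R)^{1/2}`, i.e. `u(R)² = θ √R`, the largest
admissible cap. -/
def capSpeed (θ R : ℝ) : ℝ := Real.sqrt (θ * Real.sqrt R)

/-- `u(R)² = θ √R` (`θ ≥ 0`). -/
theorem capSpeed_sq {θ : ℝ} (hθ : 0 ≤ θ) (R : ℝ) : capSpeed θ R ^ 2 = θ * Real.sqrt R :=
  Real.sq_sqrt (mul_nonneg hθ (Real.sqrt_nonneg R))

/-- `u(R) > 0` for `θ, R > 0`. -/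
theorem capSpeed_pos {θ R : ℝ} (hθ : 0 < θ) (hR : 0 < R) : 0 < capSpeed θ R :=
  Real.sqrt_pos.2 (mul_pos hθ (Real.sqrt_pos.2 hR))

/-- `u(R) ≥ 0`. -/
theorem capSpeed_nonneg (θ R : ℝ) : 0 ≤ capSpeed θ R := Real.sqrt_nonneg _

/-- Along the schedule the tail factor is `2^{3/2} e^{-√R/4}` (`θ > 0`). -/
theorem tailC_capSpeed {θ : ℝ} (hθ : 0 < θ) (R : ℝ) : tailC θ (capSpeed θ R) = (2 : ℝ) ^ ((3 : ℝ) / 2) * exp (-(Real.sqrt R / 4)) := by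
  rw [tailC, capSpeed_sq hθ.le]
  congr 2
  field_simp

/-- `u(R) ≤ 1 + θ R` for `R ≥ 1` (`θ ≥ 0`): the cap grows slower than linearly. -/
theorem capSpeed_le {θ : ℝ} (hθ : 0 ≤ θ) {R : ℝ} (hR : 1 ≤ R) : capSpeed θ R ≤ 1 + θ * R := by
  have h1 : capSpeed θ R ≤ 1 + capSpeed θ R ^ 2 := by nlinarith [sq_nonneg (capSpeed θ R - 1), capSpeed_nonneg θ R]
  rw [capSpeed_sq hθ] at h1
  refine h1.trans ?_
  have hsqrt : Real.sqrt R ≤ R := by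
    rw [Real.sqrt_le_left (by linarith)]
    nlinarith
  nlinarith [mul_le_mul_of_nonneg_left hsqrt hθ]

/-- **Decay of the assembled bound**: for every `η > 0` there is `R₀ > 0` with
`(1 + R)³ e^{-√R/4} ≤ η` for all `R ≥ R₀`. -/
theorem exists_cube_mul_exp_neg_sqrt_le {η : ℝ} (hη : 0 < η) :
    ∃ R₀ : ℝ, 0 < R₀ ∧ ∀ R : ℝ, R₀ ≤ R → (1 + R) ^ 3 * exp (-(Real.sqrt R / 4)) ≤ η := by
  have hlim := Real.tendsto_pow_mul_exp_neg_atTop_nhds_zero 6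
  have hev : ∀ᶠ x in atTop, x ^ 6 * exp (-x) ≤ η / 4913 :=
    (hlim.eventually (ge_mem_nhds (by positivity : (0 : ℝ) < η / 4913))).mono fun x hx => hx
  obtain ⟨X₀, hX₀⟩ := eventually_atTop.1 hev
  set Y := max X₀ 1 with hY
  refine ⟨16 * Y ^ 2, by positivity, fun R hR => ?_⟩
  have hY1 : 1 ≤ Y := le_max_right _ _
  have hR0 : 0 ≤ R := le_trans (by positivity) hR
  set x := Real.sqrt R / 4 with hx
  have hxY : Y ≤ x := by
    rw [hx, le_div_iff₀ (by norm_num : (0 : ℝ) < 4)]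
    have : Real.sqrt (16 * Y ^ 2) = Y * 4 := by
      rw [show (16 : ℝ) * Y ^ 2 = (Y * 4) ^ 2 by ring, Real.sqrt_sq (by positivity)]
    rw [← this]
    exact Real.sqrt_le_sqrt hR
  have hx1 : 1 ≤ x := hY1.trans hxY
  have hRx : R = 16 * x ^ 2 := by
    rw [hx, div_pow, Real.sq_sqrt hR0]; ring
  have hpoly : (1 + R) ^ 3 ≤ 4913 * x ^ 6 := by
    rw [hRx]
    have h17 : 1 + 16 * x ^ 2 ≤ 17 * x ^ 2 := by nlinarith
    calc (1 + 16 * x ^ 2) ^ 3 ≤ (17 * x ^ 2) ^ 3 := pow_le_pow_left₀ (by positivity) h17 3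
      _ = 4913 * x ^ 6 := by ring
  have hx6 := hX₀ x ((le_max_left _ _).trans hxY)
  calc (1 + R) ^ 3 * exp (-(Real.sqrt R / 4)) ≤ 4913 * x ^ 6 * exp (-x) := by
        rw [← hx]; gcongr
    _ = 4913 * (x ^ 6 * exp (-x)) := by ring
    _ ≤ 4913 * (η / 4913) := by gcongr
    _ = η := by ring

/-! ## The Gaussian flux integrals of the collision-flux bounds -/

/-- The two-velocity Gaussian flux integral of the fast event:
`I_fast = ∫ ‖w - v‖ 𝟙{u < ‖v - c‖} dγ(v) dγ(w)`, `γ = N(c, θ)`. -/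
def fastFlux (c : V3) (θ u : ℝ) : ℝ≥0∞ :=
  ∫⁻ p, ENNReal.ofReal ‖p.2 - p.1‖ * {p : V3 × V3 | u < ‖p.1 - c‖}.indicator 1 p
    ∂((gaussMeasure c θ).prod (gaussMeasure c θ))

/-- The indicator weight of the fast event is measurable. -/
theorem measurable_fastWeight (c : V3) (u : ℝ) :
    Measurable fun p : V3 × V3 => ({p : V3 × V3 | u < ‖p.1 - c‖}.indicator (1 : V3 × V3 → ℝ≥0∞) p) :=
  measurable_one.indicator (measurableSet_lt measurable_const (measurable_fst.sub measurable_const).norm)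

/-- The enlarged radius of the one-window majorant: `ρ̃(v_j, v_i) = ρ + (‖v_j‖ + V) τ + τ (‖v_j‖ + ‖v_i‖)`. -/
def nearRadius (ρ V τ : ℝ) (p : V3 × V3) : ℝ := ρ + (‖p.1‖ + V) * τ + τ * (‖p.1‖ + ‖p.2‖)

/-- The enlarged radius is measurable. -/
theorem measurable_nearRadius (ρ V τ : ℝ) : Measurable (nearRadius ρ V τ) := by
  unfold nearRadius; fun_prop

/-- The enlarged radius is nonnegative for `ρ, V, τ ≥ 0`. -/
theorem nearRadius_nonneg {ρ V τ : ℝ} (hρ : 0 ≤ ρ) (hV : 0 ≤ V) (hτ : 0 ≤ τ) (p : V3 × V3) :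
    0 ≤ nearRadius ρ V τ p := by
  unfold nearRadius; positivity

/-- The three-velocity Gaussian integral of the localised window bound:
`J₃ = ∫ ‖v_k - v_j‖ ρ̃(v_j, v_i)³ 𝟙{u < ‖v_j - c‖} dγ(v_j) dγ(v_k) dγ(v_i)`, `γ = N(c, θ)`
(variables ordered `((v_j, v_k), v_i)`). -/
def nearFlux (c : V3) (θ u ρ V τ : ℝ) : ℝ≥0∞ :=
  ∫⁻ q, ENNReal.ofReal ‖q.1.2 - q.1.1‖ * ENNReal.ofReal (nearRadius ρ V τ (q.1.1, q.2) ^ 3) *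
      {q : (V3 × V3) × V3 | u < ‖q.1.1 - c‖}.indicator 1 q
    ∂(((gaussMeasure c θ).prod (gaussMeasure c θ)).prod (gaussMeasure c θ))

/-- The three-velocity indicator weight of the fast event is measurable. -/
theorem measurable_fastWeight₃ (c : V3) (u : ℝ) :
    Measurable fun q : (V3 × V3) × V3 => ({q : (V3 × V3) × V3 | u < ‖q.1.1 - c‖}.indicator (1 : (V3 × V3) × V3 → ℝ≥0∞) q) :=
  measurable_one.indicator (measurableSet_lt measurable_const (measurable_fst.fst.sub measurable_const).norm)

/-- The ball-term integral of the time-`0` event: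
`J₁ = ∫ (ρ + (‖v‖ + V) τ)³ 𝟙{u < ‖v - c‖} dγ(v)`. -/
def ballFlux (c : V3) (θ u ρ V τ : ℝ) : ℝ≥0∞ :=
  ∫⁻ v, ENNReal.ofReal ((ρ + (‖v‖ + V) * τ) ^ 3) * {v : V3 | u < ‖v - c‖}.indicator 1 v ∂(gaussMeasure c θ)

/-! ## Collision sums and the packaged one-window pair events -/

section Flow

variable {σ : ℝ} {N : ℕ}

/-- The COLLISION SUM of a mark `F` along the orbit of `z` over `[0, τ]` (the quantity bounded by
`measure_collisionSum_ge_le_liminf`, written out). -/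
def collSum (Φ : Flow σ N) (τ : ℝ) (F : Phase N → Fin (N + 1) → Fin (N + 1) → ℝ≥0∞) (z : Phase N) : ℝ≥0∞ :=
  ∑ᶠ s ∈ collisionTimes G3 (hsDiameter σ N) (fun t => Φ.flow t z) ∩ Icc 0 τ,
    ∑ i' : Fin (N + 1), ∑ k : Fin (N + 1),
      (if i' ≠ k ∧ ‖G3.sepVec (Φ.flow s z i').1 (Φ.flow s z k).1‖ = hsDiameter σ N
        then F (Φ.flow s z) i' k else 0)

/-- **A summand is below the collision sum**: on a good orbit, the mark of an ordered contact pair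
`(i', k)` at a collision time `r ∈ [0, τ]` is at most the collision sum. -/
theorem le_collSum_of_contact (Φ : Flow σ N) {τ : ℝ} (F : Phase N → Fin (N + 1) → Fin (N + 1) → ℝ≥0∞)
    {z : Phase N} (hz : z ∈ Φ.good) {r : ℝ}
    (hr : r ∈ collisionTimes G3 (hsDiameter σ N) (fun t => Φ.flow t z) ∩ Icc 0 τ) {i' k : Fin (N + 1)}
    (hik : i' ≠ k) (hc : ‖G3.sepVec (Φ.flow r z i').1 (Φ.flow r z k).1‖ = hsDiameter σ N) :
    F (Φ.flow r z) i' k ≤ collSum Φ τ F z := by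
  classical
  have hfin := (Φ.isTrajectory z hz).locFinite 0 τ
  rw [collSum, finsum_mem_eq_finite_toFinset_sum _ hfin]
  have hrmem : r ∈ hfin.toFinset := hfin.mem_toFinset.2 hr
  refine le_trans ?_ (Finset.single_le_sum (f := fun s => ∑ i' : Fin (N + 1), ∑ k : Fin (N + 1),
    (if i' ≠ k ∧ ‖G3.sepVec (Φ.flow s z i').1 (Φ.flow s z k).1‖ = hsDiameter σ N
      then F (Φ.flow s z) i' k else 0)) (fun _ _ => bot_le) hrmem)
  refine le_trans ?_ (Finset.single_le_sum (f := fun i'' => ∑ k : Fin (N + 1),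
    (if i'' ≠ k ∧ ‖G3.sepVec (Φ.flow r z i'').1 (Φ.flow r z k).1‖ = hsDiameter σ N
      then F (Φ.flow r z) i'' k else 0)) (fun _ _ => bot_le) (Finset.mem_univ i'))
  refine le_trans ?_ (Finset.single_le_sum (f := fun k' =>
    (if i' ≠ k' ∧ ‖G3.sepVec (Φ.flow r z i').1 (Φ.flow r z k').1‖ = hsDiameter σ N
      then F (Φ.flow r z) i' k' else 0)) (fun _ _ => bot_le) (Finset.mem_univ k))
  simp only [if_pos (And.intro hik hc), le_refl]

/-- **One-window events for all pairs with a fixed first label** (`exists_windowEvent` with the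
swept tubes of `exists_sweptTube` and the lift inequality, packaged): for every mesh `τ / M` and
every `k` there is a measurable `E M k` containing the backward-flight contacts of `(j, k)`
(`j ≠ k`) with `∫ 𝟙_{E M k} A(v_j, v_k) dG_N ≤ 16 ε² (τ/M) ∫ ‖p.2 - p.1‖ A`. -/
theorem exists_pairEvents {a θ : ℝ} (hsd : SmallDensity uniformProfile σ) (ha : 0 < a) (hθ : 0 < θ)
    (c : V3) (hN : 1 ≤ N) (Φ : Flow σ N) {τ : ℝ} (hτ : 0 < τ) (j : Fin (N + 1))
    {A : V3 × V3 → ℝ≥0∞} (hA : Measurable A) :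
    ∃ E : ℕ → Fin (N + 1) → Set (Phase N), (∀ M k, MeasurableSet (E M k)) ∧
      (∀ (M : ℕ) (k : Fin (N + 1)), j ≠ k → ∀ w ∈ hardSphereDomain G3 (N + 1) (hsDiameter σ N), ∀ t ∈ Icc 0 (τ / M),
        ‖G3.sepVec ((freeFlight G3 (-t) w j).1) ((freeFlight G3 (-t) w k).1)‖ = hsDiameter σ N → w ∈ E M k) ∧
      ∀ (M : ℕ) (k : Fin (N + 1)), j ≠ k → ∫⁻ w, (E M k).indicator (fun w => A ((w j).2, (w k).2)) w ∂(gibbs σ a θ c N Φ) ≤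
        ENNReal.ofReal (16 * hsDiameter σ N ^ 2 * (τ / M)) *
          ∫⁻ p, ENNReal.ofReal ‖p.2 - p.1‖ * A p ∂((gaussMeasure c θ).prod (gaussMeasure c θ)) := by
  have hσ2 : σ ≤ 1 / 2 := hsd.σ_lt_half.le
  have hε : 0 < hsDiameter σ N := hsDiameter_pos hsd.σ_pos N
  have hlift : ∀ B : Set V3, MeasurableSet B →
      volume {x : T3 | ∃ k : Fin 3 → ℤ, Torus.reprSym x + Torus.latticeVec k ∈ B} ≤ volume B :=
    fun B hB => by simpa only [sub_zero] using volume_setOf_exists_reprSym_add_latticeVec_mem_le (0 : T3) hB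
  have hev : ∀ (M : ℕ) (k : Fin (N + 1)), ∃ E : Set (Phase N), MeasurableSet E ∧
      (j ≠ k → ∀ w ∈ hardSphereDomain G3 (N + 1) (hsDiameter σ N), ∀ t ∈ Icc 0 (τ / M),
        ‖G3.sepVec ((freeFlight G3 (-t) w j).1) ((freeFlight G3 (-t) w k).1)‖ = hsDiameter σ N → w ∈ E) ∧
      (j ≠ k → ∫⁻ w, E.indicator (fun w => A ((w j).2, (w k).2)) w ∂(gibbs σ a θ c N Φ) ≤
        ENNReal.ofReal (16 * hsDiameter σ N ^ 2 * (τ / M)) *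
          ∫⁻ p, ENNReal.ofReal ‖p.2 - p.1‖ * A p ∂((gaussMeasure c θ).prod (gaussMeasure c θ))) := by
    intro M k
    by_cases hjk : j ≠ k
    · have hh : 0 ≤ τ / M := div_nonneg hτ.le (Nat.cast_nonneg M)
      obtain ⟨S, hSm, hSvol, hS⟩ := exists_sweptTube hε hh
      obtain ⟨E, hEm, hEc, hEb⟩ := exists_windowEvent hσ2 ha hθ c hh hjk
        (fun T hT => posGibbs_pairEvent_le hsd hN hjk hT) hSm hSvol hS hlift
      exact ⟨E, hEm, fun _ => hEc, fun _ => hEb Φ A hA⟩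
    · exact ⟨∅, MeasurableSet.empty, fun h => absurd h hjk, fun h => absurd h hjk⟩
  choose E hEm hEc hEb using hev
  exact ⟨E, hEm, hEc, hEb⟩

/-- `M · (16 ε² (τ / M)) ≤ 16 ε² τ` in `ℝ≥0∞` (equality for `M ≥ 1`, and `0` for `M = 0`). -/
theorem natCast_mul_ofReal_div_le (M : ℕ) (C τ : ℝ) :
    (M : ℝ≥0∞) * ENNReal.ofReal (C * (τ / M)) ≤ ENNReal.ofReal (C * τ) := by
  rcases Nat.eq_zero_or_pos M with rfl | hM
  · simp
  · have hM' : (0 : ℝ) < M := by exact_mod_cast hM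
    rw [← ENNReal.ofReal_natCast, ← ENNReal.ofReal_mul (Nat.cast_nonneg _)]
    refine le_of_eq (congrArg ENNReal.ofReal ?_)
    field_simp

end Flow

end TrueCaps

end

end Summit.AtomisticToContinuum.HydrodynamicLimit.Theorems.TrueAnchoredInfection
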